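import Literature.Probability.Percolation.SlabRSWGluingCore
import Literature.Probability.Percolation.SlabGluingRouting
import HarnessLib

/-!
# Newman–Tassion–Wu 2017, §3.2 — the gluing lemmas for slabs: from a route to a surgery

Topic: `Literature/Probability/Percolation`. Third file of the port of §3 of Newman–Tassion–Wu,
*Critical percolation and the minimal spanning tree in slabs* (CPAM 70 (2017); arXiv:1512.09107).
`SlabRSWGluingCore.lean` proves everything about one local surgery of the main gluing lemma
(Thm. 3.7) given its data `GlueData.Surgery`. This file assembles that data from

* the cleared planar set `D ⊆ R ∖ (A ∪ B)` and the decomposition of `Γ = Γ_min^S(A,B)` at its first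
  and last vertices in `D̄` (`exists_decomp`: `Γ = p₀ ++ E₁ :: mid ++ E₂ :: s₀`, `p₀, s₀ ≠ []`
  off `D̄`, `E₁ ≠ E₂`, as soon as `Γ` has two distinct vertices in `D̄`),
* a ROUTE in the sense of the tree's `RouteSpec` (`SlabGluingRouting.lean`, DST's "three disjoint
  self-avoiding paths": a self-avoiding lattice trunk `L` from `E₁` to `E₂` over a trunk region,
  a junction `c`, a branch `Br` over `D` to the port location `w'`, with the forward condition),
* the port data: a lattice neighbour `q₁ ∉ D̄` of `w'` that is `ω`-joined to `C̄` inside `(R ∖ D)‾`,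

into a `GlueData.Surgery` with cleared set `D` (`exists_surgery_of_route`). It also provides the
three ADAPTERS used by the geometric layer to move a terminal of a route by one lattice step
(`RouteSpec.cons_trunk`, `RouteSpec.concat_trunk`, `RouteSpec.concat_branch`): the tree's routing
theorem `exists_route` works inside full boxes, while `E₁`, `E₂`, `w'` may sit on a rim of the
cleared set next to the target segment `B`.

## Sources

* C. M. Newman, V. Tassion, W. Wu, *Critical percolation and the minimal spanning tree in slabs*,
  Comm. Pure Appl. Math. 70 (2017), arXiv:1512.09107: §3.2, Definition 3.1 (the three disjoint
  paths `γ_u, γ_v, γ_w`) and the proof of Theorem 3.7, steps (1)–(3) [NewmanTassionWu2017].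
* H. Duminil-Copin, V. Sidoravicius, V. Tassion, CPAM 69 (2016), §2.3 (the tree's `RouteSpec`,
  `exists_route`).
-/

noncomputable section

namespace Literature.Probability.Percolation

open MeasureTheory LatticeModels SimpleGraph Filter Topology

namespace NTW17

variable {k : ℕ}

/-! ## Adapters: moving a terminal of a route by one lattice step -/

section Adapters

variable {RP RP' Db Db' : Set (ℤ × ℤ)} {E₁ E₁' E₂ E₂' w' w'' c : slab 3 k} {L Br : List (slab 3 k)}

/-- **Prepending a vertex to the trunk of a route.** [cite: NewmanTassionWu2017, §3.2 (proof of Theorem 3.7, step (3), the path γ_u)] -/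
theorem RouteSpec.cons_trunk (h : RouteSpec k RP Db E₁' E₂ w' L Br c) (hRP : RP ⊆ RP')
    (hadj : (slabGraph 3 k).Adj E₁ E₁') (hE₁L : E₁ ∉ L) (hE₁Br : E₁ ∉ Br)
    (hE₁RP : planar k E₁ ∈ RP') : RouteSpec k RP' Db E₁ E₂ w' (E₁ :: L) Br c where
  hL := h.hL.cons hadj hE₁L
  hL_sub := by
    intro v hv
    rcases List.mem_cons.1 hv with rfl | hv
    · exact hE₁RP
    · exact hRP (h.hL_sub v hv)
  hc := List.mem_cons_of_mem _ h.hc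
  hcE₂ := h.hcE₂
  hBr := h.hBr
  hCB := h.hCB
  hBr_sub := h.hBr_sub
  hBr_L := by
    intro v hv hvL
    rcases List.mem_cons.1 hvL with rfl | hvL
    · exact hE₁Br hv
    · exact h.hBr_L v hv hvL
  hfwd := by
    intro l₁ l₂ y heq b₀ hb₀
    rcases l₁ with _ | ⟨x, l₁'⟩
    · -- `c = E₁`: impossible, `c ∈ L`
      simp only [List.nil_append, List.cons.injEq] at heq
      exact absurd (heq.1 ▸ h.hc) hE₁L
    · simp only [List.cons_append, List.cons.injEq] at heq
      exact h.hfwd l₁' l₂ y heq.2 b₀ hb₀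

/-- **Appending a vertex to the trunk of a route.** [cite: NewmanTassionWu2017, §3.2 (proof of Theorem 3.7, step (3), the path γ_v)] -/
theorem RouteSpec.concat_trunk (h : RouteSpec k RP Db E₁ E₂' w' L Br c) (hRP : RP ⊆ RP')
    (hadj : (slabGraph 3 k).Adj E₂' E₂) (hE₂L : E₂ ∉ L) (hE₂Br : E₂ ∉ Br)
    (hE₂RP : planar k E₂ ∈ RP') : RouteSpec k RP' Db E₁ E₂ w' (L ++ [E₂]) Br c where
  hL := h.hL.concat hadj hE₂L
  hL_sub := by
    intro v hv
    rcases List.mem_append.1 hv with hv | hv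
    · exact hRP (h.hL_sub v hv)
    · rw [List.mem_singleton] at hv
      rw [hv]; exact hE₂RP
  hc := List.mem_append_left _ h.hc
  hcE₂ := fun hc => hE₂L (hc ▸ h.hc)
  hBr := h.hBr
  hCB := h.hCB
  hBr_sub := h.hBr_sub
  hBr_L := by
    intro v hv hvL
    rcases List.mem_append.1 hvL with hvL | hvL
    · exact h.hBr_L v hv hvL
    · rw [List.mem_singleton] at hvL
      exact hE₂Br (hvL ▸ hv)
  hfwd := by
    intro l₁ l₂ y heq b₀ hb₀
    -- `L ++ [E₂] = l₁ ++ c :: y :: l₂`: since `c ≠ E₂'`... we locate `c` in `L`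
    obtain ⟨L₁, y', L₂, hL⟩ : ∃ L₁ y' L₂, L = L₁ ++ c :: y' :: L₂ := by
      obtain ⟨L₁, L₂, hL⟩ := List.append_of_mem h.hc
      rcases L₂ with _ | ⟨y', L₂'⟩
      · -- `c` is the last vertex of `L`, i.e. `c = E₂'`: excluded
        exfalso
        have := h.hL.last
        rw [hL, List.getLast?_eq_some_getLast (by simp)] at this
        simp at this
        exact h.hcE₂ this
      · exact ⟨L₁, y', L₂', hL⟩
    have hkey := h.hfwd L₁ L₂ y' hL b₀ hb₀
    -- identify `y = y'` from the two decompositions of `L ++ [E₂]`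
    have hnd : (L ++ [E₂]).Nodup := (h.hL.concat hadj hE₂L).nodup
    have h1 : L ++ [E₂] = L₁ ++ c :: (y' :: (L₂ ++ [E₂])) := by rw [hL]; simp
    have hc1 : c ∉ L₁ := by
      have hn := h.hL.nodup; rw [hL, List.nodup_append] at hn
      intro hc; exact hn.2.2 c hc c (by simp) rfl
    have hc2 : c ∉ l₁ := by
      rw [heq, List.nodup_append] at hnd
      intro hc; exact hnd.2.2 c hc c (by simp) rfl
    obtain ⟨-, h2⟩ := split_unique (h1.symm.trans heq) hc1 hc2
    have hy : y = y' := by simpa using (List.cons.inj h2).1.symm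
    rw [hy]; exact hkey

/-- **Appending a vertex to the branch of a route.** [cite: NewmanTassionWu2017, §3.2 (proof of Theorem 3.7, step (3), the path γ_w)] -/
theorem RouteSpec.concat_branch (h : RouteSpec k RP Db E₁ E₂ w'' L Br c) (hDb : Db ⊆ Db')
    (hadj : (slabGraph 3 k).Adj w'' w') (hw'L : w' ∉ L) (hw'Br : w' ∉ c :: Br)
    (hw'D : planar k w' ∈ Db') : RouteSpec k RP Db' E₁ E₂ w' L (Br ++ [w']) c where
  hL := h.hL
  hL_sub := h.hL_sub
  hc := h.hc
  hcE₂ := h.hcE₂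
  hBr := by simp
  hCB := by
    have := h.hCB.concat hadj hw'Br
    simpa using this
  hBr_sub := by
    intro v hv
    rcases List.mem_append.1 hv with hv | hv
    · exact hDb (h.hBr_sub v hv)
    · rw [List.mem_singleton] at hv
      rw [hv]; exact hw'D
  hBr_L := by
    intro v hv hvL
    rcases List.mem_append.1 hv with hv | hv
    · exact h.hBr_L v hv hvL
    · rw [List.mem_singleton] at hv
      exact hw'L (hv ▸ hvL)
  hfwd := by
    intro l₁ l₂ y heq b₀ hb₀
    refine h.hfwd l₁ l₂ y heq b₀ ?_
    rw [List.head?_append, List.head?_eq_some_head h.hBr] at hb₀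
    rw [List.head?_eq_some_head h.hBr]
    simpa using hb₀

/-- Weakening the regions of a route. [cite: NewmanTassionWu2017, §3.2 (proof of Theorem 3.7)] -/
theorem RouteSpec.mono (h : RouteSpec k RP Db E₁ E₂ w' L Br c) (hRP : RP ⊆ RP') (hDb : Db ⊆ Db') :
    RouteSpec k RP' Db' E₁ E₂ w' L Br c where
  hL := h.hL
  hL_sub := fun v hv => hRP (h.hL_sub v hv)
  hc := h.hc
  hcE₂ := h.hcE₂
  hBr := h.hBr
  hCB := h.hCB
  hBr_sub := fun v hv => hDb (h.hBr_sub v hv)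
  hBr_L := h.hBr_L
  hfwd := h.hfwd

end Adapters

/-! ## The decomposition of `Γ` at a cleared set -/

section Decomp

variable {Q : GlueData} {ω : BondConfig (slab 3 k)}

/-- **The decomposition of `Γ` at the cleared set** (NTW: "`u′, v′` … the first and last vertices
of `Γ(ω)` which are in `\overline{B_{r+1}(z)}`"): if `D` avoids `A` and `B` and `Γ` has two distinct
vertices in `D̄`, then `Γ = p₀ ++ E₁ :: mid ++ E₂ :: s₀` with `p₀, s₀` non-empty and off `D̄`,
`E₁ ≠ E₂` in `D̄`. [cite: NewmanTassionWu2017, §3.2 (proof of Theorem 3.7, step (1))] -/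
theorem exists_decomp (hA : ω ∈ Q.evAB k) {D : Set (ℤ × ℤ)} (hDA : ∀ z ∈ D, z ∉ Q.A)
    (hDB : ∀ z ∈ D, z ∉ Q.B)
    (htwo : ∃ x ∈ Q.γ k ω, ∃ y ∈ Q.γ k ω, x ≠ y ∧ planar k x ∈ D ∧ planar k y ∈ D) :
    ∃ (p₀ : List (slab 3 k)) (E₁ : slab 3 k) (mid : List (slab 3 k)) (E₂ : slab 3 k)
      (s₀ : List (slab 3 k)),
      Q.γ k ω = p₀ ++ E₁ :: (mid ++ E₂ :: s₀) ∧ p₀ ≠ [] ∧ s₀ ≠ [] ∧ (∀ x ∈ p₀, planar k x ∉ D) ∧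
        (∀ x ∈ s₀, planar k x ∉ D) ∧ planar k E₁ ∈ D ∧ planar k E₂ ∈ D ∧ E₁ ≠ E₂ := by
  obtain ⟨hγO, -⟩ := Q.γ_spec hA
  set γ := Q.γ k ω with hγdef
  obtain ⟨x, hxγ, y, hyγ, hxy, hxD, hyD⟩ := htwo
  obtain ⟨p₀, E₁, rest₁, hγ1, hE₁D, hp₀D⟩ :=
    exists_first_split (p := fun v => planar k v ∈ D) γ ⟨x, hxγ, hxD⟩
  have hp₀ : p₀ ≠ [] := by
    rintro rfl
    have h := hγO.head_mem hγO.ne_nil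
    simp only [hγ1, List.nil_append, List.head_cons, mem_slabLift_iff] at h
    exact hDA _ hE₁D h
  -- `γ` visits `D̄` after `E₁`: one of `x, y` lies in `rest₁`
  have hmeet : ∃ v ∈ rest₁, planar k v ∈ D := by
    have aux : ∀ v ∈ γ, planar k v ∈ D → v ≠ E₁ → v ∈ rest₁ := by
      intro v hv hvD hvE
      rw [hγ1] at hv
      rcases List.mem_append.1 hv with h | h
      · exact absurd hvD (hp₀D v h)
      · rcases List.mem_cons.1 h with h | h
        · exact absurd h hvE
        · exact h
    by_cases hxE : x = E₁
    · exact ⟨y, aux y hyγ hyD (fun h => hxy (hxE.trans h.symm)), hyD⟩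
    · exact ⟨x, aux x hxγ hxD hxE, hxD⟩
  obtain ⟨mid, E₂, s₀, hrest, hE₂D, hs₀D⟩ :=
    exists_last_split (p := fun v => planar k v ∈ D) rest₁ hmeet
  have hγeq : γ = p₀ ++ E₁ :: (mid ++ E₂ :: s₀) := by rw [hγ1, hrest]
  have hs₀ : s₀ ≠ [] := by
    rintro rfl
    have h := hγO.last_mem hγO.ne_nil
    have : γ.getLast hγO.ne_nil = E₂ := by
      rw [List.getLast_congr _ (by simp) hγeq]; simp
    rw [this, mem_slabLift_iff] at h
    exact hDB _ hE₂D h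
  have hE₁₂ : E₁ ≠ E₂ := by
    intro h
    have hnd := hγO.nodup
    rw [hγeq, List.nodup_append] at hnd
    have := (List.nodup_cons.1 hnd.2.1).1
    exact this (by rw [h]; simp)
  exact ⟨p₀, E₁, mid, E₂, s₀, hγeq, hp₀, hs₀, hp₀D, hs₀D, hE₁D, hE₂D, hE₁₂⟩

end Decomp

/-! ## From a route to a surgery -/

section Assemble

variable {Q : GlueData} {ω : BondConfig (slab 3 k)}

/-- **A route plus port data is a surgery.** Given `ω ∈ evX`, a cleared planar set `D ⊆ R` off
`A` and `B`, a trunk region `Dt ⊆ D ∩ S`, two distinct vertices of `Γ` over `D`, a port vertex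
`q₁ ∉ D̄` adjacent to `w'` and `ω`-joined to `C̄` inside `(R ∖ D)‾`, and a route for EVERY pair of
candidate end-vertices over `D`, there is a surgery with cleared set `D`.
[cite: NewmanTassionWu2017, §3.2 (proof of Theorem 3.7, steps (1)–(3))] -/
theorem exists_surgery_of_route (hX : ω ∈ Q.evX k) {D Dt : Set (ℤ × ℤ)} (hDR : D ⊆ Q.R)
    (hDA : ∀ z ∈ D, z ∉ Q.A) (hDB : ∀ z ∈ D, z ∉ Q.B) (hDt : Dt ⊆ D) (hDtS : Dt ⊆ Q.S)
    (htwo : ∃ x ∈ Q.γ k ω, ∃ y ∈ Q.γ k ω, x ≠ y ∧ planar k x ∈ D ∧ planar k y ∈ D)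
    {w' q₁ cC : slab 3 k} (hadj : (slabGraph 3 k).Adj w' q₁) (hq₁D : planar k q₁ ∉ D)
    (hcC : cC ∈ slabLift k Q.C) (hσ : ω ∈ openConnIn (slabLift k (Q.R \ D)) q₁ cC)
    (hroute : ∀ E₁ E₂ : slab 3 k, E₁ ∈ Q.γ k ω → E₂ ∈ Q.γ k ω → E₁ ≠ E₂ →
      planar k E₁ ∈ D → planar k E₂ ∈ D → ∃ L Br c, RouteSpec k Dt D E₁ E₂ w' L Br c) :
    ∃ sx : Q.Surgery k ω, sx.D = D := by
  have hA : ω ∈ Q.evAB k := Q.evAB_of_evX hX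
  obtain ⟨p₀, E₁, mid, E₂, s₀, hγeq, hp₀, hs₀, hp₀D, hs₀D, hE₁D, hE₂D, hE₁₂⟩ :=
    exists_decomp hA hDA hDB htwo
  have hE₁γ : E₁ ∈ Q.γ k ω := by rw [hγeq]; simp
  have hE₂γ : E₂ ∈ Q.γ k ω := by rw [hγeq]; simp
  obtain ⟨L, Br, c, spec⟩ := hroute E₁ E₂ hE₁γ hE₂γ hE₁₂ hE₁D hE₂D
  set P := L.tail.dropLast with hP
  have hLeq : L = E₁ :: (P ++ [E₂]) := spec.hL.eq_cons_dropLast_concat hE₁₂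
  have hPL : ∀ v ∈ P, v ∈ L := fun v hv => by
    rw [hLeq]; exact List.mem_cons_of_mem _ (List.mem_append_left _ hv)
  -- the branch followed by the port vertex
  have hw'Br : w' ∈ Br := by
    have h1 := spec.hCB.last
    rw [List.getLast?_cons, List.getLast?_eq_some_getLast spec.hBr] at h1
    have : Br.getLast spec.hBr = w' := by simpa using h1
    rw [← this]; exact List.getLast_mem _
  have hq₁CB : q₁ ∉ c :: Br := by
    intro h
    rcases List.mem_cons.1 h with rfl | h
    · exact hq₁D (hDt (spec.hL_sub _ spec.hc))
    · exact hq₁D (spec.hBr_sub _ h)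
  have hCBq : SPath ((c :: Br) ++ [q₁]) c q₁ := spec.hCB.concat hadj hq₁CB
  have hc : c ∈ E₁ :: P := by
    have := spec.hc
    rw [hLeq] at this
    rcases List.mem_cons.1 this with h | h
    · exact List.mem_cons.2 (Or.inl h)
    · rcases List.mem_append.1 h with h | h
      · exact List.mem_cons_of_mem _ h
      · rw [List.mem_singleton] at h
        exact absurd h spec.hcE₂
  refine ⟨⟨D, p₀, E₁, mid, E₂, s₀, P, c, Br, q₁, cC, hDR, hDA, hDB, hγeq, hp₀, hs₀, hp₀D, hs₀D,
    hE₁D, hE₂D,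
    fun x hx => hDt (spec.hL_sub x (hPL x hx)),
    fun x hx => hDtS (spec.hL_sub x (hPL x hx)),
    hLeq ▸ spec.hL.chain, hLeq ▸ spec.hL.nodup, hc, spec.hBr_sub, hq₁D,
    by simpa using hCBq.chain, by simpa using hCBq.nodup,
    fun x hx => hLeq ▸ spec.hBr_L x hx, fun l₁ l₂ y h => ?_, hcC, hσ⟩, rfl⟩
  -- the forward condition: `(Br ++ [q₁]).head = Br.head`
  have hh : (Br ++ [q₁]).head (by simp) = Br.head spec.hBr := by
    simp [List.head_append_of_ne_nil spec.hBr]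
  rw [hh]
  exact spec.hfwd l₁ l₂ y (hLeq.trans h) _ (List.head?_eq_some_head spec.hBr ▸ rfl)

end Assemble

end NTW17

end Literature.Probability.Percolation
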